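import Literature.MathematicalPhysics.QuantumFieldTheory.Balaban1983to89.T4CurrencyMatching
import Summits.QuantumFields.BalabanUV.T4Continuum.Spine.NE4.FadingFromRateRealAnalytic

/-!
# Spine/NE4/FadingFromRateRelAnalytic — the PRINTED-DOMAIN rung: the REAL NE4 + real-analytic charts of RELATIVE radius `ρ·g` give
# LOG-currency history moduli with γ-FREE constants; node U2 closes by `T4CurrencyMatching`'s rate-loss fixed point — ONE radius, NO
# asymptotic-freedom lower bound, NO analyticity at `g = 0`, NO complex history family

Cell `pub-balaban-gaps` (YM blitz G2), seat `ne4`, generation 7 (unit `pub-balaban-gaps-ne4-g7`); record `HOME/ne/NE4.md` §5 (R40).  Sequel of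
`Spine/NE4/FadingFromRateRealAnalytic` (g6, (R37)) and `Spine/NE4/FadingFromRateLocalAnalytic` (g7, (R39): charts of UNIFORM radius `r` — which, like
g5∕g6's `Nbhd r γ`, force analyticity THROUGH `g = 0` and put `1∕min(r, γ∕2)` into the constants, whence TWO radii).

THE POINT.  The honest analyticity domain in a coupling `g` is a disc of radius PROPORTIONAL to `g` — the tree's node-U3 record
`T4CouplingAnalyticity.CouplingAnalyticRel` types that disc shape for the TERMS (its docstring's located reading of [Balaban1988RG2Cluster]
Lemma 1 (1.34) p. 9 *"{B: |B| < ε₁g_k^{−1} on Y}"*: complex `g` on a disc of radius `c·g_k` keeps `|zB| < (1+c)ε₁`).  **`LocalAnalyticRel B γ ρ β`**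
(§1) types it for the β-functions, on the REAL family only: about every real coupling `x ∈ ]0,γ]` the real one-coupling section
`t ↦ β_{k+1}(p; g_i := t)` has a holomorphic chart on the disc of radius `ρ·x`, bounded by `B`, agreeing with it at the real box points within `ρ·x`.
The two-constants engine at `x` with slit `ρx∕2` (§4) gives `|∂β_{k+1}∕∂g_i|(x) ≤ Λ₂ k i∕x` with the **γ-FREE** `Λ₂ k i = K·θ^{a}·(1 + a·log(1∕θ))²`,
`a = k − i`, `K = relAnalyticConst = 4e³E₀∕ρ`, `E₀ = oscConst c θ B`; the `1∕g` is absorbed EXACTLY by the **LOG CURRENCY**: with `g = e^u` the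
mean value inequality in `u ≤ log γ` gives `|β_{k+1}(p; g_i := t) − β_{k+1}(p)| ≤ Λ₂ k i·|log t − log p_i|` (`abs_sub_update_le_log_of_localAnalyticRel`),
hence (§5, telescoping `histLipschitzBy_of_coordModuli` of §3) `T4CurrencyMatching.HistLipschitzBy Real.log Λ₂ γ β ∧ ∀ θ′ > θ, FadingMemory C₂(θ′) θ′ Λ₂`
(`histLipschitzLog_fadingMemory_of_localAnalyticRel`).  Node U2 then closes by the tree's RATE-LOSS kernel in the log currency
(`T4CurrencyMatching.injectedRate_of_runs_by`, `currencyWeight_log`: sup weight `γ²∕2`, NO weight sum, hence NO `EventualLowerH`): rates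
`θ < θ′ < ρ′ < 1`, window `C₂(θ′)·(γ²∕2)·ρ′∕(ρ′ − θ′) ≤ (1 − ρ′)∕2` — **γ²-TYPE with γ-free constants**, so it HOLDS for every `γ ≤ γ₀(c, θ, B, ρ, θ′, ρ′)`
with hypotheses and runs on the SAME box: **ONE RADIUS** — the node-U2 faces are in the sequel `Spine/NE4/FadingFromRateRelAnalyticU2`
(β-generic `injectedRate_of_localAnalyticRel`, data faces, END TO END from NE5 + (R)); THIS file ends with the headline (§5).  §1 also records g6's
pair {`ExtendsC`, `CoordAnalyticC B γ r`} ⟹ `LocalAnalyticRel B γ ρ` for `ρ·γ ≤ r` (`localAnalyticRel_of_coordAnalyticC`).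

RESULT FOR THE ROW (NE4.md (R40)): node U2's input list, SIXTH and most print-faithful typed form — β-side {REAL NE4 as typed; relative real-analytic
charts of the REAL sections, uniform `(B, ρ)`}, flow-side {the PRINTED upper bound `BetaUpperH β′` with `γ²β′ < 1` (to run (0.20) forward), tuned runs} —
NOTHING ELSE: no `EventualLowerH b γ k₀`, no second radius, no window binder, no complex family, no analyticity at `g = 0`; output geometric and
K-uniform at any rate `ρ′ ∈ ]θ,1[`.  Unprinted remain NE4 itself and the UNIFORMITY in `(k, i)` of the analyticity clause.

WHAT IS NOT CLAIMED.  That Bałaban's `β_{j+1}` satisfy `LocalAnalyticRel` (the (1.34) reading is node U3's located READING of the small-field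
representation, not a printed statement about β); any modulus in the earlier couplings (G-t4-U2-2); NE4 (G-t4-U2-1).  HONEST FRAMING: hypothesis
shapes + elementary complex analysis + the tree's rate-loss bookkeeping; nothing of Bałaban's asserted beyond print; NE4 NOT IN PRINT, NOT PROVED;
binders 0∕6, spine PROVED 0∕9 unchanged; NOT the continuum limit on ℝ⁴, NOT infinite volume, NOT a mass gap, NOT Clay.  0 sorry; axioms standard;
imports `Spine/NE4/FadingFromRateRealAnalytic` + Literature `T4CurrencyMatching`; modifies nothing.
References (TYPES ∕ SHAPES only): [Balaban1987RG1] = T. Bałaban, CMP **109** (1987) 249–301, (0.20) p. 256, §1 p. 264, p. 298; [Balaban1988RG2Cluster]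
= T. Bałaban, CMP **116** (1988) 1–22, Lemma 1 (1.34) p. 9.
-/

noncomputable section

namespace Summit.QuantumFields.BalabanUV.T4Continuum.Spine.NE4

open Set Metric Filter Topology
open Literature.MathematicalPhysics.QuantumFieldTheory.Balaban1983to89
open Literature.MathematicalPhysics.QuantumFieldTheory.Balaban1983to89.FlowStep
open Literature.MathematicalPhysics.QuantumFieldTheory.Balaban1983to89.T4CouplingMatching
open Literature.MathematicalPhysics.QuantumFieldTheory.Balaban1983to89.T4Continuum
open Literature.MathematicalPhysics.QuantumFieldTheory.Balaban1983to89.T4CurrencyMatching (HistLipschitzBy)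

universe u

/-! ## §1 The shape: real-analytic charts of RELATIVE radius `ρ·g` about every real coupling -/

/-- [shape] HYPOTHESIS SHAPE — **RELATIVE REAL-ANALYTIC CHARTS OF THE REAL ONE-COUPLING SECTIONS**: for every `k`, real box history `p`,
coordinate `i ≤ k` and real coupling `x ∈ ]0,γ]` some `Φ` holomorphic on the open disc of radius `ρ·x` about `x`, bounded by `B` there, has
`Φ(t) = β_{k+1}(p; g_i := t)` for the real `t ∈ ]0,γ]` with `|t − x| < ρ·x`.  The radius SHRINKS with the coupling (no analyticity at `g = 0`) —
the disc shape of `T4CouplingAnalyticity.CouplingAnalyticRel` (node U3's located reading of [Balaban1988RG2Cluster] (1.34)); `B`, `ρ` uniform.  Printed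
TYPE for `i = k` only ([Balaban1987RG1] p. 264; uniformity in `k` unprinted, G-adv2-3), UNPRINTED for `i < k` (G-t4-U2-2).  NOT a fact. [folklore] -/
def LocalAnalyticRel (B γ ρ : ℝ) (β : HBeta) : Prop :=
  ∀ k (p : Fin (k + 1) → ℝ), p ∈ Box γ k → ∀ (i : Fin (k + 1)) (x : ℝ), x ∈ Ioc (0 : ℝ) γ →
    ∃ Φ : ℂ → ℂ, DifferentiableOn ℂ Φ (ball (x : ℂ) (ρ * x)) ∧ (∀ z ∈ ball (x : ℂ) (ρ * x), ‖Φ z‖ ≤ B) ∧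
      ∀ t ∈ Ioc (0 : ℝ) γ, |t - x| < ρ * x → Φ (t : ℂ) = (β k (Function.update p i t) : ℂ)

/-- [bookkeeping] **THE UNIFORM BOUND IS INSIDE THE SHAPE**: `LocalAnalyticRel B γ ρ β` (`ρ > 0`) gives `|β_{k+1}| ≤ B` on the boxes. [folklore] -/
theorem bound_of_localAnalyticRel {β : HBeta} {B γ ρ : ℝ} (hL : LocalAnalyticRel B γ ρ β) (hρ : 0 < ρ) :
    ∀ k (v : Fin (k + 1) → ℝ), v ∈ Box γ k → |β k v| ≤ B := by
  intro k v hv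
  have h0 : v 0 ∈ Ioc (0 : ℝ) γ := (mem_box.mp hv) 0
  have hr : 0 < ρ * v 0 := mul_pos hρ h0.1
  obtain ⟨Φ, -, hbnd, hagree⟩ := hL k v hv 0 (v 0) h0
  have h := hbnd (v 0 : ℂ) (mem_ball_self hr)
  rw [hagree (v 0) h0 (by simpa using hr), Function.update_eq_self, Complex.norm_real, Real.norm_eq_abs] at h
  exact h

/-- [bookkeeping] The shape is monotone in the relative radius (so `ρ ≤ 1` below is no restriction). [folklore] -/
theorem localAnalyticRel_mono {β : HBeta} {B γ ρ ρ' : ℝ} (hL : LocalAnalyticRel B γ ρ β) (hρ' : ρ' ≤ ρ) :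
    LocalAnalyticRel B γ ρ' β := by
  intro k p hp i x hx
  obtain ⟨Φ, hdiff, hbnd, hagree⟩ := hL k p hp i x hx
  have hsub : ball (x : ℂ) (ρ' * x) ⊆ ball (x : ℂ) (ρ * x) := ball_subset_ball (mul_le_mul_of_nonneg_right hρ' hx.1.le)
  exact ⟨Φ, hdiff.mono hsub, fun z hz => hbnd z (hsub hz),
    fun t ht htx => hagree t ht (htx.trans_le (mul_le_mul_of_nonneg_right hρ' hx.1.le))⟩

/-- [bookkeeping] **g6's PAIR IMPLIES THE SHAPE**: a complex extension `βc` (`ExtendsC`) with `CoordAnalyticC B γ r βc` gives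
`LocalAnalyticRel B γ ρ β` whenever `ρ·γ ≤ r` (the disc of radius `ρ·x ≤ r` about a box point lies in `Nbhd r γ`). [folklore] -/
theorem localAnalyticRel_of_coordAnalyticC {β : HBeta} {βc : HBetaC} {B γ r ρ : ℝ} (hE : ExtendsC β βc)
    (hA : CoordAnalyticC B γ r βc) (hρ : 0 ≤ ρ) (hργ : ρ * γ ≤ r) : LocalAnalyticRel B γ ρ β := by
  intro k p hp i x hx
  obtain ⟨U, -, hUsub, hdiff, hbnd⟩ := hA k p hp i
  have hρx : ρ * x ≤ r := (mul_le_mul_of_nonneg_left hx.2 hρ).trans hργ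
  have hball : ball (x : ℂ) (ρ * x) ⊆ Nbhd r γ := fun z hz =>
    mem_nbhd_of_mem_closedBall hx (closedBall_subset_closedBall hρx (ball_subset_closedBall hz))
  refine ⟨fun z => βc k (Function.update (fun j => (p j : ℂ)) i z), hdiff.mono (hball.trans hUsub),
    fun z hz => hbnd z (hball hz), fun t _ _ => ?_⟩
  show βc k (Function.update (fun j => (p j : ℂ)) i (t : ℂ)) = (β k (Function.update p i t) : ℂ)
  rw [← hE k (Function.update p i t)]
  congr 1; funext j
  exact (Function.apply_update (fun _ (y : ℝ) => (y : ℂ)) p i t j).symm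

/-! ## §1b Non-vacuity WITHOUT analyticity at `0`: the flat family `exp(−1∕g_k)` -/

/-- The history-free family `β_{k+1}(g_0,…,g_k) = exp(−1∕g_k)` — `C^∞` on `[0, γ]`, FLAT and NOT analytic at `g = 0` (the shape of a
large-field contribution), a toy. [folklore] -/
def flatFamily : HBeta := fun k v => Real.exp (-(v (Fin.last k))⁻¹)

/-- The flat family is Markovian: its scale shift vanishes (`ScaleShiftRate 0 θ γ`). [folklore] -/
theorem scaleShiftRate_flatFamily (θ γ : ℝ) : ScaleShiftRate 0 θ γ flatFamily := by
  intro k w _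
  have h : Fin.tail w (Fin.last k) = w (Fin.last (k + 1)) := by rw [Fin.tail, Fin.succ_last]
  simp [flatFamily, h]

/-- **THE FLAT FAMILY HAS RELATIVE CHARTS** (`ρ < 1`, bound `1`): about `x > 0` the chart in the last coupling is `z ↦ exp(−1∕z)` on the disc
of radius `ρx`, which avoids `0` and lies in `Re z > 0` (so `|exp(−1∕z)| ≤ 1`); in the other couplings the section is constant.  So
`LocalAnalyticRel` does NOT force analyticity at `g = 0` (contrast `CoordAnalyticC` ∕ `LocalAnalytic`, whose discs of fixed radius about small
couplings contain `0`). [folklore] -/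
theorem localAnalyticRel_flatFamily {γ ρ : ℝ} (hρ1 : ρ < 1) : LocalAnalyticRel 1 γ ρ flatFamily := by
  intro k p hp i x hx
  have hx0 : 0 < x := hx.1
  by_cases hi : i = Fin.last k
  · subst hi
    have hre : ∀ z ∈ ball (x : ℂ) (ρ * x), 0 < z.re := fun z hz => by
      have h1 : ‖z - (x : ℂ)‖ < ρ * x := mem_ball_iff_norm.mp hz
      have h2 : |(z - (x : ℂ)).re| ≤ ‖z - (x : ℂ)‖ := Complex.abs_re_le_norm _
      have h3 : (z - (x : ℂ)).re = z.re - x := by simp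
      rw [h3] at h2
      have h4 : x - z.re < ρ * x := lt_of_le_of_lt ((neg_sub z.re x ▸ neg_le_abs (z.re - x))) (h2.trans_lt h1)
      nlinarith
    have hne : ∀ z ∈ ball (x : ℂ) (ρ * x), z ≠ 0 := fun z hz hz0 => by
      have := hre z hz; rw [hz0, Complex.zero_re] at this; exact lt_irrefl _ this
    refine ⟨fun z => Complex.exp (-z⁻¹), fun z hz => ((differentiableAt_inv (hne z hz)).neg.cexp).differentiableWithinAt,
      fun z hz => ?_, fun t ht _ => ?_⟩
    · rw [Complex.norm_exp, Complex.neg_re, Complex.inv_re]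
      calc Real.exp (-(z.re / Complex.normSq z)) ≤ Real.exp 0 :=
            Real.exp_le_exp.mpr (neg_nonpos.mpr (div_nonneg (hre z hz).le (Complex.normSq_nonneg _)))
        _ = 1 := Real.exp_zero
    · simp only [flatFamily, Function.update_self]
      push_cast
      rfl
  · refine ⟨fun _ => (flatFamily k p : ℂ), differentiableOn_const _, fun z _ => ?_, fun t _ _ => ?_⟩
    · rw [Complex.norm_real, Real.norm_eq_abs, flatFamily, abs_of_pos (Real.exp_pos _)]
      exact Real.exp_le_one_iff.mpr (neg_nonpos.mpr (inv_nonneg.mpr ((mem_box.mp hp) (Fin.last k)).1.le))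
    · simp only [flatFamily, Function.update_of_ne (Ne.symm hi)]

/-! ## §2 The γ-FREE constants -/

/-- `K = 4e³·E₀∕ρ`, `E₀ = oscConst c θ B` (the two-constants bound with slit length `ρx∕2`, times the `x` the log currency absorbs). [folklore] -/
def relAnalyticConst (c θ B ρ : ℝ) : ℝ := 4 * Real.exp 3 * oscConst c θ B / ρ

/-- `0 ≤ relAnalyticConst c θ B ρ`. [folklore] -/
theorem relAnalyticConst_nonneg {c θ B ρ : ℝ} (hc : 0 ≤ c) (hθ0 : 0 < θ) (hθ1 : θ < 1) (hρ : 0 < ρ) :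
    0 ≤ relAnalyticConst c θ B ρ := by
  have hE := oscConst_nonneg (B := B) hc hθ0 hθ1
  unfold relAnalyticConst; positivity

/-- THE LOG-CURRENCY MODULI `Λ₂ k i = K·θ^{k−i}·(1 + (k−i)·log(1∕θ))²` — no `γ`, no `r`. [folklore] -/
def relAnalyticModuli (c θ B ρ : ℝ) : ℕ → ℕ → ℝ :=
  fun k i => relAnalyticConst c θ B ρ * θ ^ (k - i) * (1 + ((k - i : ℕ) : ℝ) * (-Real.log θ)) ^ 2

/-- `0 ≤ relAnalyticModuli c θ B ρ k i`. [folklore] -/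
theorem relAnalyticModuli_nonneg {c θ B ρ : ℝ} (hc : 0 ≤ c) (hθ0 : 0 < θ) (hθ1 : θ < 1) (hρ : 0 < ρ) (k i : ℕ) :
    0 ≤ relAnalyticModuli c θ B ρ k i :=
  mul_nonneg (mul_nonneg (relAnalyticConst_nonneg hc hθ0 hθ1 hρ) (pow_nonneg hθ0.le _)) (sq_nonneg _)

/-- The fading constant at rate `θ′`: `C₂(θ′) = K·max(1, 2log(1∕θ)∕log(θ′∕θ))²`. [folklore] -/
def relAnalyticFading (c θ B ρ θ' : ℝ) : ℝ :=
  relAnalyticConst c θ B ρ * max 1 (2 * (-Real.log θ) / Real.log (θ' / θ)) ^ 2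

/-- `0 ≤ relAnalyticFading c θ B ρ θ′`. [folklore] -/
theorem relAnalyticFading_nonneg {c θ B ρ : ℝ} (hc : 0 ≤ c) (hθ0 : 0 < θ) (hθ1 : θ < 1) (hρ : 0 < ρ) (θ' : ℝ) :
    0 ≤ relAnalyticFading c θ B ρ θ' :=
  mul_nonneg (relAnalyticConst_nonneg hc hθ0 hθ1 hρ) (sq_nonneg _)

/-! ## §3 Telescoping in a currency -/

/-- **TELESCOPING IN THE CURRENCY `φ`**: if changing coordinate `i` alone costs `Λ k i·|φ(t) − φ(p_i)|` on the box, then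
`HistLipschitzBy φ Λ γ β` (one coordinate at a time; the `φ = id` case is `FadingFromRate.histLipschitz_of_coordModuli`). [folklore] -/
theorem histLipschitzBy_of_coordModuli {β : HBeta} {φ : ℝ → ℝ} {γ : ℝ} {Λ : ℕ → ℕ → ℝ}
    (h : ∀ k (p : Fin (k + 1) → ℝ), p ∈ Box γ k → ∀ (i : Fin (k + 1)) (t : ℝ), t ∈ Ioc (0 : ℝ) γ →
      |β k (Function.update p i t) - β k p| ≤ Λ k i * |φ t - φ (p i)|) :
    HistLipschitzBy φ Λ γ β := by
  intro k p q hp hq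
  -- `mix m`: `q` strictly below `m`, `p` from `m` on
  let mix : ℕ → (Fin (k + 1) → ℝ) := fun m j => if (j : ℕ) < m then q j else p j
  have hmix_box : ∀ m, mix m ∈ Box γ k := fun m => by
    rw [mem_box]; intro j
    by_cases hj : (j : ℕ) < m
    · simp only [mix, hj, if_true]; exact (mem_box.mp hq) j
    · simp only [mix, hj, if_false]; exact (mem_box.mp hp) j
  have hmix_self : ∀ m (hm : m < k + 1), mix m ⟨m, hm⟩ = p ⟨m, hm⟩ := fun m hm => by
    simp only [mix, lt_irrefl, if_false]
  have hmix_succ : ∀ m (hm : m < k + 1), mix (m + 1) = Function.update (mix m) ⟨m, hm⟩ (q ⟨m, hm⟩) := fun m hm => by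
    funext j
    by_cases hj : j = ⟨m, hm⟩
    · subst hj; simp [mix]
    · have hjm : (j : ℕ) ≠ m := fun e => hj (Fin.ext e)
      rw [Function.update_of_ne hj]
      simp only [mix]
      by_cases hlt : (j : ℕ) < m
      · simp [hlt, Nat.lt_succ_of_lt hlt]
      · have : ¬ (j : ℕ) < m + 1 := by omega
        simp [hlt, this]
  have main : ∀ m, m ≤ k + 1 →
      |β k (mix m) - β k p| ≤ ∑ i ∈ (Finset.univ.filter fun i : Fin (k + 1) => (i : ℕ) < m), Λ k i * |φ (q i) - φ (p i)| := by
    intro m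
    induction m with
    | zero =>
      intro _
      have h0 : mix 0 = p := funext fun j => by simp [mix]
      simp [h0]
    | succ m ih =>
      intro hm
      have hm' : m < k + 1 := Nat.lt_of_succ_le hm
      have step := h k (mix m) (hmix_box m) ⟨m, hm'⟩ (q ⟨m, hm'⟩) ((mem_box.mp hq) ⟨m, hm'⟩)
      rw [← hmix_succ m hm', hmix_self m hm'] at step
      have hfilter : (Finset.univ.filter fun i : Fin (k + 1) => (i : ℕ) < m + 1)
          = insert ⟨m, hm'⟩ (Finset.univ.filter fun i : Fin (k + 1) => (i : ℕ) < m) := by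
        ext j
        simp only [Finset.mem_filter, Finset.mem_univ, true_and, Finset.mem_insert, Fin.ext_iff]
        omega
      have hnot : (⟨m, hm'⟩ : Fin (k + 1)) ∉ (Finset.univ.filter fun i : Fin (k + 1) => (i : ℕ) < m) := by simp
      rw [hfilter, Finset.sum_insert hnot]
      calc |β k (mix (m + 1)) - β k p| ≤ |β k (mix (m + 1)) - β k (mix m)| + |β k (mix m) - β k p| := abs_sub_le _ _ _
        _ ≤ _ := add_le_add step (ih hm'.le)
  have hlast : mix (k + 1) = q := funext fun j => by simp [mix, j.isLt]
  have hall : (Finset.univ.filter fun i : Fin (k + 1) => (i : ℕ) < k + 1) = Finset.univ :=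
    Finset.filter_true_of_mem fun j _ => j.isLt
  have hk := main (k + 1) le_rfl
  rw [hlast, hall] at hk
  rw [abs_sub_comm]
  refine hk.trans (le_of_eq (Finset.sum_congr rfl fun i _ => ?_))
  rw [abs_sub_comm]

/-! ## §4 Real NE4 + relative charts: the coordinatewise LOG-Lipschitz bound -/

/-- **COORDINATEWISE LOG-LIPSCHITZ FROM THE REAL NE4 + RELATIVE CHARTS.**  Under the REAL `ScaleShiftRate c θ γ β` (`c ≥ 0`, `0 < θ < 1`) and
`LocalAnalyticRel B γ ρ β` (`B > 0`, `0 < ρ ≤ 1`, `γ > 0`): changing the ONE coupling `g_i` of a real box history within `]0,γ]` moves `β_{k+1}` by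
at most `Λ₂ k i·|log g_i′ − log g_i|`, `Λ₂ = relAnalyticModuli c θ B ρ` (γ-FREE): at each real `x` the chart is `2B`-oscillation-bounded on the disc
of radius `s = ρx∕2` and `ε = E₀θ^a`-close to its centre value along the real slit of length `s` inside the box (NE4's oscillation cap), so
`‖Φ_x′(x)‖ ≤ 2e³εL²∕s ≤ Λ₂ k i∕x`; the real section has that derivative WITHIN `]0,γ]` at `x`; with `g = e^u` the bound is UNIFORM in `u` and the
mean value inequality in `u ≤ log γ` concludes. [folklore] -/
theorem abs_sub_update_le_log_of_localAnalyticRel {β : HBeta} {c θ γ ρ B : ℝ} (hL : LocalAnalyticRel B γ ρ β)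
    (hS : ScaleShiftRate c θ γ β) (hc : 0 ≤ c) (hθ0 : 0 < θ) (hθ1 : θ < 1) (hB : 0 < B) (hρ : 0 < ρ) (hρ1 : ρ ≤ 1)
    (hγ : 0 < γ) {k : ℕ} {p : Fin (k + 1) → ℝ} (hp : p ∈ Box γ k) (i : Fin (k + 1)) {t : ℝ} (ht : t ∈ Ioc (0 : ℝ) γ) :
    |β k (Function.update p i t) - β k p| ≤ relAnalyticModuli c θ B ρ k i * |Real.log t - Real.log (p i)| := by
  have hbound := bound_of_localAnalyticRel hL hρ
  set a : ℕ := k - (i : ℕ) with ha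
  set E₀ : ℝ := oscConst c θ B with hE₀
  have hE₀B : 2 * B ≤ E₀ := le_max_left _ _
  have hE₀pos : 0 < E₀ := lt_of_lt_of_le (by linarith) hE₀B
  set ε : ℝ := E₀ * θ ^ a with hε
  have hεpos : 0 < ε := mul_pos hE₀pos (pow_pos hθ0 a)
  set M : ℝ := max (2 * B) ε with hM
  have hεM : ε ≤ M := le_max_right _ _
  set Λki : ℝ := relAnalyticModuli c θ B ρ k i with hΛki
  -- the REAL one-coupling section, `ℂ`-valued
  let g : ℝ → ℂ := fun u => (β k (Function.update p i u) : ℂ)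
  have hbox : ∀ u ∈ Ioc (0 : ℝ) γ, Function.update p i u ∈ Box γ k := fun u hu => by
    rw [mem_box] at hp ⊢
    intro j; by_cases hj : j = i
    · subst hj; simpa using hu
    · rw [Function.update_of_ne hj]; exact hp j
  have hosc : ∀ u ∈ Ioc (0 : ℝ) γ, ∀ u' ∈ Ioc (0 : ℝ) γ, ‖g u - g u'‖ ≤ ε := by
    intro u hu u' hu'
    change ‖(β k (Function.update p i u) : ℂ) - (β k (Function.update p i u') : ℂ)‖ ≤ ε
    rw [← Complex.ofReal_sub, Complex.norm_real, Real.norm_eq_abs]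
    refine abs_sub_le_of_agree_young' hS hc hθ0 hθ1 hbound (Nat.lt_succ_iff.mp i.isLt) (hbox u hu) (hbox u' hu')
      fun j hj => ?_
    have hji : j ≠ i := fun h => by subst h; exact lt_irrefl _ hj
    rw [Function.update_of_ne hji, Function.update_of_ne hji]
  -- the logarithm: `max(1, log(M/ε))² ≤ (1 + a·log(1/θ))²`
  have hℓ : 0 ≤ -Real.log θ := by have := Real.log_neg hθ0 hθ1; linarith
  have hlog : Real.log (M / ε) ≤ (a : ℝ) * (-Real.log θ) := by
    rcases le_or_gt (2 * B) ε with h | h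
    · rw [show M = ε from max_eq_right h, div_self hεpos.ne', Real.log_one]; positivity
    · have hq : M / ε ≤ (θ ^ a)⁻¹ := by
        rw [show M = 2 * B from max_eq_left h.le, div_le_iff₀ hεpos, hε]
        calc 2 * B ≤ E₀ := hE₀B
          _ = (θ ^ a)⁻¹ * (E₀ * θ ^ a) := by field_simp
      calc Real.log (M / ε) ≤ Real.log ((θ ^ a)⁻¹) := Real.log_le_log (div_pos (by linarith) hεpos) hq
        _ = (a : ℝ) * (-Real.log θ) := by rw [Real.log_inv, Real.log_pow]; ring
  have hL2 : max 1 (Real.log (M / ε)) ^ 2 ≤ (1 + (a : ℝ) * (-Real.log θ)) ^ 2 :=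
    pow_le_pow_left₀ (zero_le_one.trans (le_max_left _ _))
      (max_le (le_add_of_nonneg_right (by positivity)) (by linarith)) 2
  -- at every real coupling: a derivative WITHIN the interval with norm `≤ Λki / x`
  have hderiv : ∀ x ∈ Ioc (0 : ℝ) γ, ∃ φ' : ℂ, HasDerivWithinAt g φ' (Ioc (0 : ℝ) γ) x ∧ ‖φ'‖ ≤ Λki / x := by
    intro x hx
    obtain ⟨Φ, hdiff, hbnd, hagree⟩ := hL k p hp i x hx
    have hx0 : 0 < x := hx.1
    have hr : 0 < ρ * x := mul_pos hρ hx0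
    set s : ℝ := ρ * x / 2 with hs_def
    have hs : 0 < s := by positivity
    have hsr : s < ρ * x := by rw [hs_def]; linarith
    have hsx : s ≤ x / 2 := by rw [hs_def]; nlinarith
    have hballU : closedBall (x : ℂ) s ⊆ ball (x : ℂ) (ρ * x) := closedBall_subset_ball hsr
    have hΦx : Φ (x : ℂ) = g x := hagree x hx (by simpa using hr)
    have hΦreal : ∀ u ∈ Ioc (0 : ℝ) γ, |u - x| ≤ s → Φ (u : ℂ) = g u := fun u hu hus =>
      hagree u hu (lt_of_le_of_lt hus hsr)
    have hMdisc : ∀ z ∈ closedBall (x : ℂ) s, ‖Φ z - Φ x‖ ≤ M := fun z hz =>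
      calc ‖Φ z - Φ x‖ ≤ ‖Φ z‖ + ‖Φ x‖ := norm_sub_le _ _
        _ ≤ B + B := add_le_add (hbnd z (hballU hz)) (hbnd (x : ℂ) (mem_ball_self hr))
        _ = 2 * B := by ring
        _ ≤ M := le_max_left _ _
    have hd : ‖deriv Φ (x : ℂ)‖ ≤ 2 * Real.exp 3 * ε * max 1 (Real.log (M / ε)) ^ 2 / s := by
      rcases le_or_gt x (γ / 2) with hxr | hxl
      · refine norm_deriv_le_of_oneSided_right hs hεpos hεM isOpen_ball hballU hdiff hMdisc fun u hxu hus => ?_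
        have hu : u ∈ Ioc (0 : ℝ) γ := ⟨hx0.trans_le hxu, by linarith⟩
        rw [hΦreal u hu (by rw [abs_of_nonneg (by linarith)]; linarith), hΦx]
        exact hosc u hu x hx
      · refine norm_deriv_le_of_oneSided_left hs hεpos hεM isOpen_ball hballU hdiff hMdisc fun u hsu hux => ?_
        have hu : u ∈ Ioc (0 : ℝ) γ := ⟨by linarith, hux.trans hx.2⟩
        rw [hΦreal u hu (by rw [abs_of_nonpos (by linarith)]; linarith), hΦx]
        exact hosc u hu x hx
    have hfold : 2 * Real.exp 3 * ε * max 1 (Real.log (M / ε)) ^ 2 / s ≤ Λki / x := by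
      rw [hΛki, show relAnalyticModuli c θ B ρ k i = 4 * Real.exp 3 * E₀ / ρ * θ ^ a * (1 + (a : ℝ) * (-Real.log θ)) ^ 2
        from rfl, hs_def, div_le_div_iff₀ hs hx0]
      have h1 : 2 * Real.exp 3 * ε * max 1 (Real.log (M / ε)) ^ 2 * x
          ≤ 2 * Real.exp 3 * ε * (1 + (a : ℝ) * (-Real.log θ)) ^ 2 * x :=
        mul_le_mul_of_nonneg_right (mul_le_mul_of_nonneg_left hL2 (by positivity)) hx0.le
      refine h1.trans (le_of_eq ?_)
      rw [hε]; field_simp; ring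
    have hΦat : HasDerivAt (fun u : ℝ => Φ (u : ℂ)) (deriv Φ (x : ℂ)) x :=
      (hdiff.differentiableAt (isOpen_ball.mem_nhds (mem_ball_self hr))).hasDerivAt.comp_ofReal
    have hcongr : g =ᶠ[𝓝[Ioc (0 : ℝ) γ] x] fun u : ℝ => Φ (u : ℂ) := by
      have hnhd : Ioc (0 : ℝ) γ ∩ Ioo (x - s) (x + s) ∈ 𝓝[Ioc (0 : ℝ) γ] x :=
        inter_mem_nhdsWithin _ (Ioo_mem_nhds (show x - s < x by linarith) (show x < x + s by linarith))
      filter_upwards [hnhd] with u hu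
      exact (hΦreal u hu.1 (abs_sub_lt_iff.mpr ⟨by linarith [hu.2.2], by linarith [hu.2.1]⟩).le).symm
    exact ⟨deriv Φ (x : ℂ), hΦat.hasDerivWithinAt.congr_of_eventuallyEq hcongr hΦx.symm, hd.trans hfold⟩
  choose! φ' hφ' using hderiv
  -- the substitution `g = e^u`: a UNIFORM derivative bound on `u ≤ log γ`
  let G : ℝ → ℂ := fun v => g (Real.exp v)
  have hmaps : MapsTo Real.exp (Iic (Real.log γ)) (Ioc (0 : ℝ) γ) := fun v hv =>
    ⟨Real.exp_pos v, by simpa [Real.exp_log hγ] using Real.exp_le_exp.mpr (mem_Iic.mp hv)⟩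
  have hG : ∀ v ∈ Iic (Real.log γ), HasDerivWithinAt G (Real.exp v • φ' (Real.exp v)) (Iic (Real.log γ)) v := fun v hv =>
    (hφ' (Real.exp v) (hmaps hv)).1.scomp v (Real.hasDerivAt_exp v).hasDerivWithinAt hmaps
  have hGb : ∀ v ∈ Iic (Real.log γ), ‖Real.exp v • φ' (Real.exp v)‖ ≤ Λki := fun v hv => by
    have hx := hmaps hv
    have hb := (hφ' (Real.exp v) hx).2
    rw [norm_smul, Real.norm_eq_abs, abs_of_pos (Real.exp_pos v)]
    calc Real.exp v * ‖φ' (Real.exp v)‖ ≤ Real.exp v * (Λki / Real.exp v) :=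
          mul_le_mul_of_nonneg_left hb (Real.exp_pos v).le
      _ = Λki := mul_div_cancel₀ _ (Real.exp_pos v).ne'
  have hpi : p i ∈ Ioc (0 : ℝ) γ := (mem_box.mp hp) i
  have hlt : Real.log t ∈ Iic (Real.log γ) := mem_Iic.mpr (Real.log_le_log ht.1 ht.2)
  have hlp : Real.log (p i) ∈ Iic (Real.log γ) := mem_Iic.mpr (Real.log_le_log hpi.1 hpi.2)
  have hmvt := (convex_Iic (Real.log γ)).norm_image_sub_le_of_norm_hasDerivWithin_le hG hGb hlp hlt
  have e1 : G (Real.log t) = g t := by change g (Real.exp (Real.log t)) = g t; rw [Real.exp_log ht.1]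
  have e2 : G (Real.log (p i)) = (β k p : ℂ) := by
    change (β k (Function.update p i (Real.exp (Real.log (p i)))) : ℂ) = _
    rw [Real.exp_log hpi.1, Function.update_eq_self]
  rw [e1, e2] at hmvt
  change ‖(β k (Function.update p i t) : ℂ) - (β k p : ℂ)‖ ≤ _ at hmvt
  rw [← Complex.ofReal_sub, Complex.norm_real, Real.norm_eq_abs, Real.norm_eq_abs] at hmvt
  exact hmvt

/-! ## §5 The headline in the log currency: γ-free moduli, fading at every `θ′ > θ` -/

/-- **HEADLINE — LOG-CURRENCY HISTORY MODULI WITH FADING MEMORY FROM THE REAL NE4 + RELATIVE CHARTS.**  Under the REAL `ScaleShiftRate c θ γ β`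
(`c ≥ 0`, `0 < θ < 1`) and `LocalAnalyticRel B γ ρ β` (`B > 0`, `0 < ρ ≤ 1`, `γ > 0`):
`T4CurrencyMatching.HistLipschitzBy Real.log Λ₂ γ β` — `|β_{k+1}(p) − β_{k+1}(q)| ≤ Σ_i Λ₂ k i·|log p_i − log q_i|` — and
`∀ θ′ > θ, FadingMemory C₂(θ′) θ′ Λ₂`, with the γ-FREE `Λ₂ = relAnalyticModuli c θ B ρ`, `C₂ = relAnalyticFading c θ B ρ θ′`. [folklore] -/
theorem histLipschitzLog_fadingMemory_of_localAnalyticRel {β : HBeta} {c θ γ ρ B : ℝ} (hL : LocalAnalyticRel B γ ρ β)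
    (hS : ScaleShiftRate c θ γ β) (hc : 0 ≤ c) (hθ0 : 0 < θ) (hθ1 : θ < 1) (hB : 0 < B) (hρ : 0 < ρ) (hρ1 : ρ ≤ 1)
    (hγ : 0 < γ) :
    HistLipschitzBy Real.log (relAnalyticModuli c θ B ρ) γ β ∧
      ∀ θ', θ < θ' → FadingMemory (relAnalyticFading c θ B ρ θ') θ' (relAnalyticModuli c θ B ρ) := by
  refine ⟨histLipschitzBy_of_coordModuli fun k p hp i t ht =>
      abs_sub_update_le_log_of_localAnalyticRel hL hS hc hθ0 hθ1 hB hρ hρ1 hγ hp i ht, fun θ' hθθ' k i _ => ⟨?_, ?_⟩⟩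
  · exact relAnalyticModuli_nonneg hc hθ0 hθ1 hρ k i
  · have hK := relAnalyticConst_nonneg (B := B) hc hθ0 hθ1 hρ
    have key := pow_mul_sq_le_pow hθ0 hθ1 hθθ' (k - i)
    show relAnalyticConst c θ B ρ * θ ^ (k - i) * (1 + ((k - i : ℕ) : ℝ) * (-Real.log θ)) ^ 2 ≤
      relAnalyticConst c θ B ρ * max 1 (2 * (-Real.log θ) / Real.log (θ' / θ)) ^ 2 * θ' ^ (k - i)
    calc relAnalyticConst c θ B ρ * θ ^ (k - i) * (1 + ((k - i : ℕ) : ℝ) * (-Real.log θ)) ^ 2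
        = relAnalyticConst c θ B ρ * (θ ^ (k - i) * (1 + ((k - i : ℕ) : ℝ) * (-Real.log θ)) ^ 2) := by ring
      _ ≤ relAnalyticConst c θ B ρ * (max 1 (2 * (-Real.log θ) / Real.log (θ' / θ)) ^ 2 * θ' ^ (k - i)) :=
          mul_le_mul_of_nonneg_left key hK
      _ = _ := by ring

end Summit.QuantumFields.BalabanUV.T4Continuum.Spine.NE4

end
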